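import Literature.MathematicalPhysics.KineticTheory.TaggedSphereDiffusionCorrector
import Mathlib.Analysis.Fourier.AddCircleMulti
import HarnessLib

/-!
# The Fourier fibres of the tagged linear Boltzmann equation on the torus
(Bodineau–Gallagher–Saint-Raymond, Invent. Math. 203 (2016) = arXiv:1305.3397v2, (1.3) and
§6.1; a layer of the proof of the hydrodynamic limit (6.3),
`Literature.MathematicalPhysics.KineticTheory.bgsr_hydrodynamicLimit` of `TaggedSphereDiffusion`)

BGSR's linear Boltzmann equation (1.3) for the tagged sphere, `∂ₜ φ + v·∇ₓ φ = -α L φ` on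
`T^d × ℝ^d` with `L = a_β - K` acting on the velocity only, is translation invariant in `x`.
Consequently the spatial Fourier coefficients
`ψ_k(t, v) = ∫_{T^d} e^{-2πi k·x} φ(t, x, v) dx` (`kineticFibre`) of the solution decouple: each
solves the *fibred* equation `∂ₜ ψ_k + i θ_k(v) ψ_k = -α L ψ_k`, `θ_k(v) = 2π k·v`
(`fourierPhase`), a problem in the velocity variable alone. This is the form in which the
diffusive limit `φ_α(ατ) → ρ(τ)` (BGSR (6.3)) is proved in the sibling files (energy estimate in
`L²(M_β)`, then a pointwise upgrade): for the datum `ρ⁰(x)` the heat equation predicts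
`ψ_k(ατ, v) → ρ̂⁰(k) e^{-4π² κ_β |k|² τ}`.

## Main results (for the collision-series solution `φ = linearBoltzmannSeries` of
`TaggedLinearBoltzmannSeries`, datum `0 ≤ ρ⁰ ≤ R` continuous, `β > 0`, `α ≥ 0`, `d ≥ 2`)

* `kineticFibre_linearBoltzmannSeries_eq` — **the fibred mild equation in integrating-factor
  form**: for `t ≥ 0` and every `v`,
  `ψ_k(t, v) = e^{-(α a_β(v) + i θ_k(v)) t} ρ̂⁰(k) + α ∫₀ᵗ e^{-(α a_β(v) + i θ_k(v))(t-s)} (K ψ_k(s))(v) ds`,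
  `K` the gain operator in Carleman form acting on complex functions (`carlemanGainC`). It is
  obtained from the gain/loss mild equation along characteristics
  (`LinearBoltzmannData.linearBoltzmannSeries_alongFlow`) by integrating against `e^{-2πik·x} dx`,
  using the invariance of the Haar measure of `T^d` and Fubini.
* `hasDerivWithinAt_kineticFibre` — `t ↦ ψ_k(t, v)` is differentiable (from the right at `t = 0`)
  with `∂ₜ ψ_k = -(α a_β + i θ_k) ψ_k + α K ψ_k`.
* `norm_kineticFibre_le`, `continuous_kineticFibre` — `|ψ_k| ≤ R`, joint continuity in `(t, v)`.

As in `Mathlib.Analysis.Fourier.AddCircleMulti`, the measure on `ℝ/ℤ` is normalised to be the Haar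
probability measure (a local instance; Mathlib's global instance is `ENNReal.ofReal 1 • haar`,
equal but not definitionally so). The kinetic objects themselves involve no integration over
`T^d`, so this choice is internal to the Fourier analysis.

## References

* T. Bodineau, I. Gallagher, L. Saint-Raymond, *The Brownian motion as the limit of a
  deterministic system of hard-spheres*, Invent. Math. 203 (2016) 493–553 = arXiv:1305.3397v2,
  (1.3), §6.1.
* A. Bensoussan, J.-L. Lions, G. Papanicolaou, *Boundary layers and homogenization of transport
  processes*, Publ. RIMS 15 (1979) (BGSR's [6]).
-/

noncomputable section

open MeasureTheory Metric Set Filter Topology ProbabilityTheory Complex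
open scoped InnerProductSpace ENNReal NNReal Real

/-- In this file the measure on `ℝ/ℤ` is the Haar probability measure, as in
`Mathlib.Analysis.Fourier.AddCircleMulti`. [folklore] -/
local instance : MeasureSpace UnitAddCircle := ⟨AddCircle.haarAddCircle⟩

/-- The measure on `ℝ/ℤ` is a Haar measure. [folklore] -/
local instance : Measure.IsAddHaarMeasure (volume : Measure UnitAddCircle) :=
  inferInstanceAs (Measure.IsAddHaarMeasure AddCircle.haarAddCircle)

/-- The measure on `ℝ/ℤ` is a probability measure. [folklore] -/
local instance : IsProbabilityMeasure (volume : Measure UnitAddCircle) :=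
  inferInstanceAs (IsProbabilityMeasure AddCircle.haarAddCircle)

namespace Literature.MathematicalPhysics.KineticTheory

open Literature.Analysis.FunctionSpaces (maxwellianBeta maxwellianBeta_pos)
open TaggedSphereDiffusion (collisionFrequency)
open UnitAddTorus

variable {d : Type*} [Fintype d] {β α : ℝ}

local notation "𝔼" => EuclideanSpace ℝ d
local notation "𝕋" => UnitAddTorus d

/-- The measure on `(ℝ/ℤ)^d` is a probability measure. [folklore] -/
local instance instIsProbabilityMeasureTorus : IsProbabilityMeasure (volume : Measure (UnitAddTorus d)) := by
  rw [volume_pi]; infer_instance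

/-! ## Characters of the torus -/

/-- The characters are multiplicative: `e_n(x + y) = e_n(x) e_n(y)`. [folklore] -/
theorem mFourier_apply_add (n : d → ℤ) (x y : 𝕋) : mFourier n (x + y) = mFourier n x * mFourier n y := by
  simp only [mFourier, ContinuousMap.coe_mk, Pi.add_apply, fourier_apply, zsmul_add, AddCircle.toCircle_add,
    Circle.coe_mul, Finset.prod_mul_distrib]

/-- `e_{-n}(-x) = e_n(x)`. [folklore] -/
theorem mFourier_neg_apply_neg (n : d → ℤ) (x : 𝕋) : mFourier (-n) (-x) = mFourier n x := by
  simp only [mFourier, ContinuousMap.coe_mk, Pi.neg_apply, fourier_apply, neg_zsmul, zsmul_neg, neg_neg]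

/-- `|e_n(x)| = 1` (cf. `norm_mFourier_apply` of `TaggedSphereHydrodynamicReduction`, not imported
here). [folklore] -/
theorem norm_mFourier_eval_eq_one (n : d → ℤ) (x : 𝕋) : ‖mFourier n x‖ = 1 := by
  simp only [mFourier, ContinuousMap.coe_mk, norm_prod, fourier_apply, Circle.norm_coe, Finset.prod_const_one]

/-- The phase `θ_k(v) = 2π ∑ᵢ kᵢ vᵢ = 2π k·v` of the fibred equation. [folklore] -/
def fourierPhase (k : d → ℤ) (v : 𝔼) : ℝ := 2 * π * ∑ i, (k i : ℝ) * v i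

/-- The phase is continuous in `v`. [folklore] -/
@[fun_prop]
theorem continuous_fourierPhase (k : d → ℤ) : Continuous (fourierPhase (d := d) k) := by
  unfold fourierPhase
  fun_prop

/-- **Characters along the covering map**: `e_n(proj w) = e^{i θ_n(w)}`. [folklore] -/
theorem mFourier_proj (n : d → ℤ) (w : 𝔼) :
    mFourier n (Literature.Analysis.FunctionSpaces.Torus.proj w) = Complex.exp (fourierPhase n w * I) := by
  simp only [mFourier, ContinuousMap.coe_mk, Literature.Analysis.FunctionSpaces.Torus.proj_apply, fourier_coe_apply,
    ← Complex.exp_sum, fourierPhase]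
  congr 1
  push_cast
  rw [Finset.mul_sum, Finset.sum_mul]
  refine Finset.sum_congr rfl fun i _ => by ring

/-! ## The gain operator on complex functions -/

/-- The gain operator in Carleman form acting on complex functions of the velocity:
`(K g)(v) = ∫ k_β(v, u) g(v + u) du`. [cite: BodineauGallagherSaintRaymondInvent2016, §6.1.2] -/
def carlemanGainC (β : ℝ) (g : 𝔼 → ℂ) (v : 𝔼) : ℂ :=
  ∫ u, (carlemanKernel β v u : ℂ) * g (v + u)

/-- **`|K g(v)| ≤ a_β(v) sup |g|`** for bounded measurable `g`. [folklore] -/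
theorem norm_carlemanGainC_le (hd : 2 ≤ Fintype.card d) (hβ : 0 < β) {g : 𝔼 → ℂ} {C : ℝ}
    (hC : ∀ w, ‖g w‖ ≤ C) (v : 𝔼) : ‖carlemanGainC β g v‖ ≤ collisionFrequency β v * C := by
  rw [carlemanGainC, ← integral_carlemanKernel hd hβ v, ← integral_mul_const]
  refine (norm_integral_le_integral_norm _).trans (integral_mono_of_nonneg (Eventually.of_forall fun u => norm_nonneg _)
    ((integrable_carlemanKernel hd hβ v).mul_const C) (Eventually.of_forall fun u => ?_))
  simp only
  rw [norm_mul, Complex.norm_real, Real.norm_of_nonneg (carlemanKernel_nonneg β v u)]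
  exact mul_le_mul_of_nonneg_left (hC _) (carlemanKernel_nonneg β v u)

/-- The Carleman integrand of a bounded measurable `g` is integrable. [folklore] -/
theorem integrable_carlemanKernel_mul_complex (hd : 2 ≤ Fintype.card d) (hβ : 0 < β) {g : 𝔼 → ℂ}
    (hg : Measurable g) {C : ℝ} (hC : ∀ w, ‖g w‖ ≤ C) (v : 𝔼) :
    Integrable fun u => (carlemanKernel β v u : ℂ) * g (v + u) := by
  refine ((integrable_carlemanKernel hd hβ v).mul_const C).mono' ?_ (Eventually.of_forall fun u => ?_)
  · exact (Complex.measurable_ofReal.comp (measurable_carlemanKernel_right β v)).mul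
      (hg.comp (measurable_const_add v)) |>.aestronglyMeasurable
  · rw [norm_mul, Complex.norm_real, Real.norm_of_nonneg (carlemanKernel_nonneg β v u)]
    exact mul_le_mul_of_nonneg_left (hC _) (carlemanKernel_nonneg β v u)

/-- **Parametric continuity of `K`**: for `g(y, w)` jointly continuous and bounded,
`y ↦ (K g(y, ·))(v)` is continuous (dominated convergence with the integrable majorant
`sup|g| · k_β(v, ·)`). [folklore] -/
theorem continuous_carlemanGainC_param {Y : Type*} [TopologicalSpace Y] [FirstCountableTopology Y]
    (hd : 2 ≤ Fintype.card d) (hβ : 0 < β) {g : Y → 𝔼 → ℂ} (hg : Continuous fun p : Y × 𝔼 => g p.1 p.2)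
    {C : ℝ} (hC : ∀ y w, ‖g y w‖ ≤ C) (v : 𝔼) :
    Continuous fun y => carlemanGainC β (g y) v := by
  unfold carlemanGainC
  refine continuous_of_dominated (bound := fun u => carlemanKernel β v u * C) (fun y => ?_) (fun y => ?_)
    ((integrable_carlemanKernel hd hβ v).mul_const C) ?_
  · exact (Complex.measurable_ofReal.comp (measurable_carlemanKernel_right β v)).mul
      ((hg.comp (continuous_const.prodMk continuous_id)).measurable.comp (measurable_const_add v)) |>.aestronglyMeasurable
  · refine Eventually.of_forall fun u => ?_
    rw [norm_mul, Complex.norm_real, Real.norm_of_nonneg (carlemanKernel_nonneg β v u)]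
    exact mul_le_mul_of_nonneg_left (hC _ _) (carlemanKernel_nonneg β v u)
  · refine Eventually.of_forall fun u => continuous_const.mul ?_
    exact hg.comp (continuous_id.prodMk continuous_const)

/-- `K` on real functions, cast to `ℂ`, is `K` on the cast. [folklore] -/
theorem ofReal_carlemanGain (β : ℝ) (g : 𝔼 → ℝ) (v : 𝔼) :
    ((carlemanGain β g v : ℝ) : ℂ) = carlemanGainC β (fun w => (g w : ℂ)) v := by
  rw [carlemanGain, carlemanGainC, ← integral_complex_ofReal]
  refine integral_congr_ae (Eventually.of_forall fun u => ?_)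
  push_cast; rfl

/-- Real part of `K g`: `Re (K g) = K (Re g)` (when the Carleman integral converges). [folklore] -/
theorem re_carlemanGainC {g : 𝔼 → ℂ} {v : 𝔼} (hint : Integrable fun u => (carlemanKernel β v u : ℂ) * g (v + u)) :
    (carlemanGainC β g v).re = carlemanGain β (fun w => (g w).re) v := by
  have h := Complex.reCLM.integral_comp_comm hint
  simp only [Complex.reCLM_apply] at h
  rw [carlemanGainC, carlemanGain, ← h]
  refine integral_congr_ae (Eventually.of_forall fun u => ?_)
  simp only [Complex.re_ofReal_mul]

/-- Imaginary part of `K g`: `Im (K g) = K (Im g)`. [folklore] -/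
theorem im_carlemanGainC {g : 𝔼 → ℂ} {v : 𝔼} (hint : Integrable fun u => (carlemanKernel β v u : ℂ) * g (v + u)) :
    (carlemanGainC β g v).im = carlemanGain β (fun w => (g w).im) v := by
  have h := Complex.imCLM.integral_comp_comm hint
  simp only [Complex.imCLM_apply] at h
  rw [carlemanGainC, carlemanGain, ← h]
  refine integral_congr_ae (Eventually.of_forall fun u => ?_)
  simp only [Complex.im_ofReal_mul]

/-- `K` on the cast of a real function has no imaginary part and real part `K`. [folklore] -/
theorem carlemanGainC_ofReal (β : ℝ) (g : 𝔼 → ℝ) (v : 𝔼) :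
    carlemanGainC β (fun w => (g w : ℂ)) v = (carlemanGain β g v : ℂ) :=
  (ofReal_carlemanGain β g v).symm

/-! ## The Fourier fibres of a kinetic density -/

/-- The `k`-th spatial Fourier coefficient of a kinetic density `φ(x, v)` on `T^d × ℝ^d`, as a
function of the velocity: `ψ_k(v) = ∫_{T^d} e^{-2πi k·x} φ(x, v) dx`
(Mathlib's `UnitAddTorus.mFourierCoeff`). [folklore] -/
def kineticFibre (k : d → ℤ) (φ : 𝕋 → 𝔼 → ℝ) (v : 𝔼) : ℂ :=
  mFourierCoeff (fun x => (φ x v : ℂ)) k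

/-- Unfolding: `ψ_k(v) = ∫ e_{-k}(x) φ(x, v) dx`. [folklore] -/
theorem kineticFibre_eq (k : d → ℤ) (φ : 𝕋 → 𝔼 → ℝ) (v : 𝔼) :
    kineticFibre k φ v = ∫ x, mFourier (-k) x * (φ x v : ℂ) := by
  simp only [kineticFibre, mFourierCoeff, smul_eq_mul]

/-- **`|ψ_k(v)| ≤ sup |φ|`** (the torus has mass one). [folklore] -/
theorem norm_kineticFibre_le (k : d → ℤ) {φ : 𝕋 → 𝔼 → ℝ} {C : ℝ} (hC : ∀ x w, |φ x w| ≤ C) (v : 𝔼) :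
    ‖kineticFibre k φ v‖ ≤ C := by
  rw [kineticFibre_eq]
  have h := norm_integral_le_of_norm_le_const (μ := (volume : Measure 𝕋))
    (f := fun x => mFourier (-k) x * (φ x v : ℂ)) (C := C) (Eventually.of_forall fun x => ?_)
  · simpa using h
  · rw [norm_mul, norm_mFourier_eval_eq_one, one_mul, Complex.norm_real, Real.norm_eq_abs]
    exact hC x v

/-- **Joint continuity of the fibres**: if `φ(t, x, v)` is jointly continuous then
`(t, v) ↦ ψ_k(t, v)` is continuous (parametric integral over the compact torus). [folklore] -/
theorem continuous_kineticFibre (k : d → ℤ) {φ : ℝ → 𝕋 → 𝔼 → ℝ}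
    (hφ : Continuous fun p : ℝ × 𝕋 × 𝔼 => φ p.1 p.2.1 p.2.2) :
    Continuous fun p : ℝ × 𝔼 => kineticFibre k (φ p.1) p.2 := by
  have h := continuous_parametric_integral_of_continuous (μ := (volume : Measure 𝕋))
    (f := fun (p : ℝ × 𝔼) (x : 𝕋) => mFourier (-k) x * (φ p.1 x p.2 : ℂ)) ?_ isCompact_univ
  · simpa only [Measure.restrict_univ, kineticFibre_eq] using h
  · refine ((mFourier (-k)).continuous.comp continuous_snd).mul (Complex.continuous_ofReal.comp ?_)
    exact hφ.comp ((continuous_fst.comp continuous_fst).prodMk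
      (continuous_snd.prodMk (continuous_snd.comp continuous_fst)))

/-- Continuity of a fibre in the velocity. [folklore] -/
theorem continuous_kineticFibre_right (k : d → ℤ) {φ : ℝ → 𝕋 → 𝔼 → ℝ}
    (hφ : Continuous fun p : ℝ × 𝕋 × 𝔼 => φ p.1 p.2.1 p.2.2) (t : ℝ) :
    Continuous fun v => kineticFibre k (φ t) v :=
  (continuous_kineticFibre k hφ).comp (continuous_const.prodMk continuous_id)

/-- Measurability of a fibre in the velocity. [folklore] -/
theorem measurable_kineticFibre (k : d → ℤ) {φ : ℝ → 𝕋 → 𝔼 → ℝ}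
    (hφ : Continuous fun p : ℝ × 𝕋 × 𝔼 => φ p.1 p.2.1 p.2.2) (t : ℝ) :
    Measurable fun v => kineticFibre k (φ t) v :=
  (continuous_kineticFibre_right k hφ t).measurable

/-- **Translation covariance of the fibres**: `∫ e_{-k}(x) φ(x + p, v) dx = e_k(p) ψ_k(v)`
(invariance of the Haar measure). [folklore] -/
theorem integral_mFourier_mul_translate (k : d → ℤ) (φ : 𝕋 → 𝔼 → ℝ) (p : 𝕋) (v : 𝔼) :
    ∫ x, mFourier (-k) x * (φ (x + p) v : ℂ) = mFourier k p * kineticFibre k φ v := by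
  rw [kineticFibre_eq, ← integral_const_mul]
  have h := integral_add_right_eq_self (μ := (volume : Measure 𝕋))
    (fun y => mFourier (-k) (y - p) * (φ y v : ℂ)) p
  simp only [add_sub_cancel_right] at h
  rw [h]
  refine integral_congr_ae (Eventually.of_forall fun y => ?_)
  simp only
  rw [sub_eq_add_neg, mFourier_apply_add, mFourier_neg_apply_neg]
  ring

/-- The phase is linear along rays: `θ_k(t v) = t θ_k(v)`. [folklore] -/
theorem fourierPhase_smul (k : d → ℤ) (t : ℝ) (v : 𝔼) : fourierPhase k (t • v) = t * fourierPhase k v := by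
  simp only [fourierPhase, PiLp.smul_apply, smul_eq_mul, Finset.mul_sum]
  refine Finset.sum_congr rfl fun i _ => by ring

/-- Continuous functions on the torus are integrable. [folklore] -/
theorem integrable_of_continuous_torus {f : 𝕋 → ℂ} (hf : Continuous f) : Integrable f :=
  (integrableOn_univ).1 (hf.continuousOn.integrableOn_compact isCompact_univ)

/-! ## The fibred mild equation -/

section FibreIdentity

open Literature.Analysis.FluidPDE Literature.Analysis.FunctionSpaces

variable {ρ₀ : UnitAddTorus d → ℝ} {R : ℝ}

/-- **The gain/loss mild equation of the series in Carleman form, cast to `ℂ`**: for `t ≥ 0`,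
`φ(t, x + tv, v) = e^{-α a t} ρ⁰(x) + ∫₀ᵗ e^{-α a (t-s)} α (K φ(s, x + sv, ·))(v) ds`.
[cite: BodineauGallagherSaintRaymondInvent2016, (1.3)] -/
theorem linearBoltzmannSeries_alongFlow_carleman (h : LinearBoltzmannData (Torus.geometry d) β α (fun x _ => ρ₀ x) R)
    (hd : 2 ≤ Fintype.card d) {t : ℝ} (ht : 0 ≤ t) (x : 𝕋) (v : 𝔼) :
    ((linearBoltzmannSeries (Torus.geometry d) β α (fun x _ => ρ₀ x) t (x + Torus.proj (t • v)) v : ℝ) : ℂ) =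
      (Real.exp (-(α * collisionFrequency β v * t)) : ℂ) * (ρ₀ x : ℂ) +
        ∫ s in (0 : ℝ)..t, (Real.exp (-(α * collisionFrequency β v * (t - s))) : ℂ) *
          ((α : ℂ) * carlemanGainC β
            (fun w => (linearBoltzmannSeries (Torus.geometry d) β α (fun x _ => ρ₀ x) s (x + Torus.proj (s • v)) w : ℂ)) v) := by
  have hβ := h.beta_pos
  have hflow := h.linearBoltzmannSeries_alongFlow ht x v
  simp only [Torus.geometry_translate] at hflow
  -- gain term in Carleman form
  have hK : ∀ s, linearBoltzmannGain β
      (fun w => linearBoltzmannSeries (Torus.geometry d) β α (fun x _ => ρ₀ x) s (x + Torus.proj (s • v)) w) v =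
      carlemanGain β (fun w => linearBoltzmannSeries (Torus.geometry d) β α (fun x _ => ρ₀ x) s (x + Torus.proj (s • v)) w) v := by
    intro s
    refine linearBoltzmannGain_eq_carlemanGain hd hβ (h.measurable_linearBoltzmannSeries s _) v ?_
    refine ((integrable_carlemanKernel hd hβ v).mul_const R).mono' ?_ (Eventually.of_forall fun u => ?_)
    · exact ((measurable_carlemanKernel_right β v).mul
        ((h.measurable_linearBoltzmannSeries s _).comp (measurable_const_add v))).aestronglyMeasurable
    · rw [Real.norm_eq_abs, abs_mul, abs_of_nonneg (carlemanKernel_nonneg β v u)]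
      exact mul_le_mul_of_nonneg_left (h.abs_linearBoltzmannSeries_le s _ _) (carlemanKernel_nonneg β v u)
  simp_rw [hK] at hflow
  rw [hflow]
  push_cast
  rw [← intervalIntegral.integral_ofReal]
  congr 1
  refine intervalIntegral.integral_congr fun s _ => ?_
  push_cast
  rw [ofReal_carlemanGain]

/-- Joint continuity in `(s, x)` of the Carleman gain along the flow. [folklore] -/
theorem continuous_carlemanGainC_alongFlow (h : LinearBoltzmannData (Torus.geometry d) β α (fun x _ => ρ₀ x) R)
    (hd : 2 ≤ Fintype.card d) (v : 𝔼) :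
    Continuous fun p : ℝ × 𝕋 => carlemanGainC β
      (fun w => (linearBoltzmannSeries (Torus.geometry d) β α (fun x _ => ρ₀ x) p.1 (p.2 + Torus.proj (p.1 • v)) w : ℂ)) v := by
  refine continuous_carlemanGainC_param (Y := ℝ × 𝕋) hd h.beta_pos
    (g := fun p w => (linearBoltzmannSeries (Torus.geometry d) β α (fun x _ => ρ₀ x) p.1 (p.2 + Torus.proj (p.1 • v)) w : ℂ))
    (Complex.continuous_ofReal.comp ?_) (C := R) (fun p w => ?_) v
  · exact h.continuous_linearBoltzmannSeries.comp ((continuous_fst.comp continuous_fst).prodMk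
      (((continuous_snd.comp continuous_fst).add
        (Torus.continuous_proj.comp ((continuous_fst.comp continuous_fst).smul continuous_const))).prodMk
        continuous_snd))
  · rw [Complex.norm_real, Real.norm_eq_abs]
    exact h.abs_linearBoltzmannSeries_le _ _ _

/-- **The fibred mild equation in integrating-factor form.** For the collision-series solution
`φ` of (1.3) with datum `ρ⁰(x)` and `t ≥ 0`, the spatial Fourier coefficients
`ψ_k(t, v) = ∫ e^{-2πik·x} φ(t, x, v) dx` satisfy, for every `v`,
`ψ_k(t, v) = e^{-(α a_β(v) + iθ_k(v)) t} ρ̂⁰(k) + α ∫₀ᵗ e^{-(α a_β(v) + iθ_k(v))(t-s)} (K ψ_k(s))(v) ds`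
with `θ_k(v) = 2π k·v`: the equation `∂ₜ ψ_k + iθ_k ψ_k = α (K ψ_k - a_β ψ_k)`, `ψ_k(0) = ρ̂⁰(k)`.
[cite: BodineauGallagherSaintRaymondInvent2016, (1.3) and §6.1.1] -/
theorem kineticFibre_linearBoltzmannSeries_eq (h : LinearBoltzmannData (Torus.geometry d) β α (fun x _ => ρ₀ x) R)
    (hd : 2 ≤ Fintype.card d) (k : d → ℤ) {t : ℝ} (ht : 0 ≤ t) (v : 𝔼) :
    kineticFibre k (linearBoltzmannSeries (Torus.geometry d) β α (fun x _ => ρ₀ x) t) v =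
      Complex.exp (-((α * collisionFrequency β v : ℝ) + fourierPhase k v * I) * t) *
          mFourierCoeff (fun x => (ρ₀ x : ℂ)) k +
        (α : ℂ) * ∫ s in (0 : ℝ)..t, Complex.exp (-((α * collisionFrequency β v : ℝ) + fourierPhase k v * I) * (t - s)) *
          carlemanGainC β (kineticFibre k (linearBoltzmannSeries (Torus.geometry d) β α (fun x _ => ρ₀ x) s)) v := by
  have hβ := h.beta_pos
  set Φ := linearBoltzmannSeries (Torus.geometry d) β α (fun x _ => ρ₀ x) with hΦ
  -- the Carleman gain along the flow, and the integrand of the Duhamel term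
  set F : ℝ → 𝕋 → ℂ := fun s x => (Real.exp (-(α * collisionFrequency β v * (t - s))) : ℂ) *
    ((α : ℂ) * carlemanGainC β (fun w => (Φ s (x + Torus.proj (s • v)) w : ℂ)) v) with hF
  have hFc : Continuous (Function.uncurry F) := by
    refine ((Complex.continuous_ofReal.comp (by fun_prop : Continuous fun p : ℝ × 𝕋 =>
      Real.exp (-(α * collisionFrequency β v * (t - p.1))))).mul (continuous_const.mul ?_))
    exact continuous_carlemanGainC_alongFlow h hd v
  -- Step 1: integrate the flow identity against `e_{-k}(x) dx`
  have hflow : ∀ x, ((Φ t (x + Torus.proj (t • v)) v : ℝ) : ℂ) =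
      (Real.exp (-(α * collisionFrequency β v * t)) : ℂ) * (ρ₀ x : ℂ) + ∫ s in (0 : ℝ)..t, F s x := fun x =>
    linearBoltzmannSeries_alongFlow_carleman h hd ht x v
  have hlhs : ∫ x, mFourier (-k) x * ((Φ t (x + Torus.proj (t • v)) v : ℝ) : ℂ) =
      Complex.exp (fourierPhase k v * t * I) * kineticFibre k (Φ t) v := by
    rw [integral_mFourier_mul_translate, mFourier_proj, fourierPhase_smul]
    congr 2; push_cast; ring
  -- integrability for the two Fubini swaps
  have hF_int : Integrable (Function.uncurry fun s x => mFourier (-k) x * F s x)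
      ((volume.restrict (uIoc 0 t)).prod (volume : Measure 𝕋)) := by
    have hcont : Continuous (Function.uncurry fun s x => mFourier (-k) x * F s x) :=
      ((mFourier (-k)).continuous.comp continuous_snd).mul hFc
    have hK : IsCompact (Icc 0 t ×ˢ (univ : Set 𝕋)) := isCompact_Icc.prod isCompact_univ
    have hint := hcont.continuousOn.integrableOn_compact (μ := (volume : Measure ℝ).prod (volume : Measure 𝕋)) hK
    rw [uIoc_of_le ht, Measure.restrict_prod_eq_prod_univ]
    exact hint.mono_set (prod_mono Ioc_subset_Icc_self Subset.rfl)
  have hG_int : ∀ s, Integrable (Function.uncurry fun (x : 𝕋) (u : 𝔼) =>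
      mFourier (-k) x * ((carlemanKernel β v u : ℂ) * (Φ s (x + Torus.proj (s • v)) (v + u) : ℂ)))
      ((volume : Measure 𝕋).prod volume) := by
    intro s
    have hmaj : Integrable (fun z : 𝕋 × 𝔼 => (1 : ℝ) * (R * carlemanKernel β v z.2))
        ((volume : Measure 𝕋).prod volume) :=
      (integrable_const (1 : ℝ)).mul_prod (((integrable_carlemanKernel hd hβ v).const_mul R))
    refine hmaj.mono' ?_ (Eventually.of_forall fun z => ?_)
    · refine (((mFourier (-k)).continuous.measurable.comp measurable_fst).mul
        ((Complex.measurable_ofReal.comp ((measurable_carlemanKernel_right β v).comp measurable_snd)).mul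
          (Complex.measurable_ofReal.comp ?_))).aestronglyMeasurable
      exact h.continuous_linearBoltzmannSeries.measurable.comp (measurable_const.prodMk
        ((measurable_fst.add_const _).prodMk (measurable_snd.const_add v)))
    · obtain ⟨x, u⟩ := z
      simp only [Function.uncurry_apply_pair]
      rw [norm_mul, norm_mul, norm_mFourier_eval_eq_one, Complex.norm_real, Complex.norm_real,
        Real.norm_of_nonneg (carlemanKernel_nonneg β v _), Real.norm_eq_abs, one_mul, one_mul, mul_comm R]
      exact mul_le_mul_of_nonneg_left (h.abs_linearBoltzmannSeries_le _ _ _) (carlemanKernel_nonneg β v _)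
  -- Step 2: the Duhamel term, fibre by fibre
  have hinner : ∀ s, ∫ x, mFourier (-k) x * F s x =
      (Real.exp (-(α * collisionFrequency β v * (t - s))) : ℂ) *
        ((α : ℂ) * (Complex.exp (fourierPhase k v * s * I) * carlemanGainC β (kineticFibre k (Φ s)) v)) := by
    intro s
    have h1 : ∀ x, mFourier (-k) x * F s x = (Real.exp (-(α * collisionFrequency β v * (t - s))) : ℂ) * ((α : ℂ) *
        ∫ u, mFourier (-k) x * ((carlemanKernel β v u : ℂ) * (Φ s (x + Torus.proj (s • v)) (v + u) : ℂ))) := by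
      intro x
      have h0 : mFourier (-k) x * ∫ u, (carlemanKernel β v u : ℂ) * (Φ s (x + Torus.proj (s • v)) (v + u) : ℂ) =
          ∫ u, mFourier (-k) x * ((carlemanKernel β v u : ℂ) * (Φ s (x + Torus.proj (s • v)) (v + u) : ℂ)) :=
        (integral_const_mul _ _).symm
      rw [hF]
      simp only
      rw [carlemanGainC, ← h0]
      ring
    simp_rw [h1]
    rw [integral_const_mul, integral_const_mul, integral_integral_swap (hG_int s)]
    congr 2
    have h2 : ∀ u, ∫ x, mFourier (-k) x * ((carlemanKernel β v u : ℂ) * (Φ s (x + Torus.proj (s • v)) (v + u) : ℂ)) =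
        Complex.exp (fourierPhase k v * s * I) * ((carlemanKernel β v u : ℂ) * kineticFibre k (Φ s) (v + u)) := by
      intro u
      have h3 : ∀ x, mFourier (-k) x * ((carlemanKernel β v u : ℂ) * (Φ s (x + Torus.proj (s • v)) (v + u) : ℂ)) =
          (carlemanKernel β v u : ℂ) * (mFourier (-k) x * (Φ s (x + Torus.proj (s • v)) (v + u) : ℂ)) := fun x => by ring
      simp_rw [h3]
      rw [integral_const_mul, integral_mFourier_mul_translate, mFourier_proj, fourierPhase_smul]
      push_cast; ring
    simp_rw [h2]
    rw [integral_const_mul, carlemanGainC]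
  -- integrability over the torus of the two summands
  have hρc : Continuous ρ₀ := h.continuous_data.comp (continuous_id.prodMk (continuous_const (y := (0 : 𝔼))))
  have hint_a : Integrable (fun x : 𝕋 => mFourier (-k) x * ((Real.exp (-(α * collisionFrequency β v * t)) : ℂ) * (ρ₀ x : ℂ))) :=
    integrable_of_continuous_torus
      ((mFourier (-k)).continuous.mul (continuous_const.mul (Complex.continuous_ofReal.comp hρc)))
  have hFc' : Continuous (Function.uncurry fun (x : 𝕋) (s : ℝ) => F s x) := hFc.comp continuous_swap
  have hint_b : Integrable (fun x : 𝕋 => mFourier (-k) x * ∫ s in (0 : ℝ)..t, F s x) :=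
    integrable_of_continuous_torus ((mFourier (-k)).continuous.mul
      (intervalIntegral.continuous_parametric_intervalIntegral_of_continuous' hFc' 0 t))
  -- Step 3: assemble `e^{iθt} ψ(t) = e^{-αat} ρ̂⁰ + ∫₀ᵗ e^{-αa(t-s)} α e^{iθs} K ψ(s) ds`
  have hmain : Complex.exp (fourierPhase k v * t * I) * kineticFibre k (Φ t) v =
      (Real.exp (-(α * collisionFrequency β v * t)) : ℂ) * mFourierCoeff (fun x => (ρ₀ x : ℂ)) k +
        ∫ s in (0 : ℝ)..t, (Real.exp (-(α * collisionFrequency β v * (t - s))) : ℂ) *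
          ((α : ℂ) * (Complex.exp (fourierPhase k v * s * I) * carlemanGainC β (kineticFibre k (Φ s)) v)) := by
    rw [← hlhs]
    simp_rw [hflow, mul_add]
    rw [integral_add hint_a hint_b]
    congr 1
    · rw [mFourierCoeff, ← integral_const_mul]
      refine integral_congr_ae (Eventually.of_forall fun x => ?_)
      simp only [smul_eq_mul]; ring
    · have h4 : ∀ x, mFourier (-k) x * ∫ s in (0 : ℝ)..t, F s x = ∫ s in (0 : ℝ)..t, mFourier (-k) x * F s x :=
        fun x => by rw [intervalIntegral.integral_const_mul]
      simp_rw [h4]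
      rw [← MeasureTheory.intervalIntegral_integral_swap hF_int]
      exact intervalIntegral.integral_congr fun s _ => hinner s
  -- Step 4: multiply by `e^{-iθt}`
  have hE : Complex.exp (fourierPhase k v * t * I) ≠ 0 := Complex.exp_ne_zero _
  have hψ : kineticFibre k (Φ t) v =
      (Complex.exp (fourierPhase k v * t * I))⁻¹ * (Complex.exp (fourierPhase k v * t * I) * kineticFibre k (Φ t) v) := by
    rw [← mul_assoc, inv_mul_cancel₀ hE, one_mul]
  rw [hψ, hmain, mul_add, ← intervalIntegral.integral_const_mul, ← intervalIntegral.integral_const_mul]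
  congr 1
  · rw [← mul_assoc]
    congr 1
    rw [Complex.ofReal_exp, ← Complex.exp_neg, ← Complex.exp_add]
    congr 1
    push_cast; ring
  · refine intervalIntegral.integral_congr fun s _ => ?_
    have hexp : Complex.exp (-((α * collisionFrequency β v : ℝ) + fourierPhase k v * I) * (t - s)) =
        (Complex.exp (fourierPhase k v * t * I))⁻¹ *
          (Complex.exp (-(α * collisionFrequency β v * (t - s)) : ℝ) * Complex.exp (fourierPhase k v * s * I)) := by
      rw [← Complex.exp_neg, ← Complex.exp_add, ← Complex.exp_add]
      congr 1
      push_cast; ring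
    rw [Complex.ofReal_exp, hexp]
    push_cast
    ring

/-- The fibres at time `0` are the Fourier coefficients of the datum: `ψ_k(0, v) = ρ̂⁰(k)`. [folklore] -/
theorem kineticFibre_linearBoltzmannSeries_zero (k : d → ℤ) (v : 𝔼) :
    kineticFibre k (linearBoltzmannSeries (Torus.geometry d) β α (fun x _ => ρ₀ x) 0) v =
      mFourierCoeff (fun x => (ρ₀ x : ℂ)) k := by
  rw [kineticFibre]
  congr 1
  funext x
  rw [linearBoltzmannSeries_zero]

/-- Continuity of `s ↦ (K ψ_k(s))(v)`. [folklore] -/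
theorem continuous_carlemanGainC_kineticFibre (h : LinearBoltzmannData (Torus.geometry d) β α (fun x _ => ρ₀ x) R)
    (hd : 2 ≤ Fintype.card d) (k : d → ℤ) (v : 𝔼) :
    Continuous fun s : ℝ => carlemanGainC β
      (kineticFibre k (linearBoltzmannSeries (Torus.geometry d) β α (fun x _ => ρ₀ x) s)) v :=
  continuous_carlemanGainC_param (Y := ℝ) hd h.beta_pos
    (g := fun s w => kineticFibre k (linearBoltzmannSeries (Torus.geometry d) β α (fun x _ => ρ₀ x) s) w)
    (continuous_kineticFibre k h.continuous_linearBoltzmannSeries) (C := R)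
    (fun s w => norm_kineticFibre_le k (fun x w' => h.abs_linearBoltzmannSeries_le s x w') w) v

/-- **A smooth extension of the fibre to all times.** There is `P : ℝ → ℂ`, differentiable
everywhere with `P' = c P + α K ψ_k`, `c = -(α a_β(v) + iθ_k(v))`, which agrees with
`s ↦ ψ_k(s, v)` for `s ≥ 0` (namely `P(s) = e^{cs} (ρ̂⁰(k) + α ∫₀ˢ e^{-cr} (K ψ_k(r))(v) dr)`).
[folklore] -/
theorem exists_hasDerivAt_extension_kineticFibre (h : LinearBoltzmannData (Torus.geometry d) β α (fun x _ => ρ₀ x) R)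
    (hd : 2 ≤ Fintype.card d) (k : d → ℤ) (v : 𝔼) :
    ∃ P : ℝ → ℂ,
      (∀ s, HasDerivAt P
        (-((α * collisionFrequency β v : ℝ) + fourierPhase k v * I) * P s +
          (α : ℂ) * carlemanGainC β (kineticFibre k (linearBoltzmannSeries (Torus.geometry d) β α (fun x _ => ρ₀ x) s)) v) s) ∧
      ∀ s, 0 ≤ s → kineticFibre k (linearBoltzmannSeries (Torus.geometry d) β α (fun x _ => ρ₀ x) s) v = P s := by
  set Φ := linearBoltzmannSeries (Torus.geometry d) β α (fun x _ => ρ₀ x) with hΦ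
  set c : ℂ := -((α * collisionFrequency β v : ℝ) + fourierPhase k v * I) with hc
  set G : ℝ → ℂ := fun s => carlemanGainC β (kineticFibre k (Φ s)) v with hG
  have hGc : Continuous G := continuous_carlemanGainC_kineticFibre h hd k v
  set H : ℝ → ℂ := fun s => mFourierCoeff (fun x => (ρ₀ x : ℂ)) k + (α : ℂ) * ∫ r in (0 : ℝ)..s, Complex.exp (-c * r) * G r
    with hH
  refine ⟨fun s => Complex.exp (c * s) * H s, fun t => ?_, fun s hs => ?_⟩
  · -- derivative of `H` and of `e^{ct} H(t)`
    have hcontI : Continuous fun r : ℝ => Complex.exp (-c * r) * G r :=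
      (Complex.continuous_exp.comp (continuous_const.mul Complex.continuous_ofReal)).mul hGc
    have hH' : HasDerivAt H ((α : ℂ) * (Complex.exp (-c * t) * G t)) t := by
      have h1 := intervalIntegral.integral_hasDerivAt_right (hcontI.intervalIntegrable 0 t)
        (hcontI.stronglyMeasurableAtFilter _ _) hcontI.continuousAt
      simpa [hH] using (h1.const_mul (α : ℂ)).const_add (mFourierCoeff (fun x => (ρ₀ x : ℂ)) k)
    have hE : HasDerivAt (fun s : ℝ => Complex.exp (c * s)) (c * Complex.exp (c * t)) t := by
      have h1 : HasDerivAt (fun s : ℝ => c * (s : ℂ)) c t := by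
        simpa using (Complex.ofRealCLM.hasDerivAt (x := t)).const_mul c
      have h2 := (Complex.hasDerivAt_exp (c * t)).comp t h1
      have h3 : HasDerivAt (fun s : ℝ => Complex.exp (c * s)) (Complex.exp (c * t) * c) t := h2
      convert h3 using 1
      ring
    have hP : HasDerivAt (fun s : ℝ => Complex.exp (c * s) * H s)
        (c * Complex.exp (c * t) * H t + Complex.exp (c * t) * ((α : ℂ) * (Complex.exp (-c * t) * G t))) t := hE.mul hH'
    have h2 : Complex.exp (c * t) * Complex.exp (-c * t) = 1 := by
      rw [← Complex.exp_add]; simp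
    have hP' : c * Complex.exp (c * t) * H t + Complex.exp (c * t) * ((α : ℂ) * (Complex.exp (-c * t) * G t)) =
        c * (Complex.exp (c * t) * H t) + (α : ℂ) * G t := by
      calc c * Complex.exp (c * t) * H t + Complex.exp (c * t) * ((α : ℂ) * (Complex.exp (-c * t) * G t))
          = c * (Complex.exp (c * t) * H t) + (α : ℂ) * (Complex.exp (c * t) * Complex.exp (-c * t)) * G t := by ring
        _ = _ := by rw [h2, mul_one]
    rw [hP'] at hP
    exact hP
  · -- `ψ(s) = e^{cs} H(s)` for `s ≥ 0`
    rw [hΦ, kineticFibre_linearBoltzmannSeries_eq h hd k hs v, hH]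
    simp only [← hc]
    rw [mul_add]
    congr 1
    rw [mul_left_comm]
    congr 1
    rw [← intervalIntegral.integral_const_mul]
    refine intervalIntegral.integral_congr fun r _ => ?_
    rw [← mul_assoc, ← Complex.exp_add]
    congr 1
    · congr 1; ring

/-- **The fibred equation, differential form**: for `t ≥ 0`, `s ↦ ψ_k(s, v)` has the right
derivative `-(α a_β(v) + iθ_k(v)) ψ_k(t, v) + α (K ψ_k(t))(v)` at `t` (within `[t, ∞)`;
two-sided for `t > 0`, `hasDerivAt_kineticFibre`).
[cite: BodineauGallagherSaintRaymondInvent2016, (1.3) and (6.2)] -/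
theorem hasDerivWithinAt_kineticFibre (h : LinearBoltzmannData (Torus.geometry d) β α (fun x _ => ρ₀ x) R)
    (hd : 2 ≤ Fintype.card d) (k : d → ℤ) {t : ℝ} (ht : 0 ≤ t) (v : 𝔼) :
    HasDerivWithinAt
      (fun s : ℝ => kineticFibre k (linearBoltzmannSeries (Torus.geometry d) β α (fun x _ => ρ₀ x) s) v)
      (-((α * collisionFrequency β v : ℝ) + fourierPhase k v * I) *
          kineticFibre k (linearBoltzmannSeries (Torus.geometry d) β α (fun x _ => ρ₀ x) t) v +
        (α : ℂ) * carlemanGainC β (kineticFibre k (linearBoltzmannSeries (Torus.geometry d) β α (fun x _ => ρ₀ x) t)) v)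
      (Ici t) t := by
  obtain ⟨P, hP, heq⟩ := exists_hasDerivAt_extension_kineticFibre h hd k v
  rw [heq t ht]
  exact (hP t).hasDerivWithinAt.congr (fun s hs => heq s (ht.trans hs)) (heq t ht)

/-- For `t > 0` the derivative of `s ↦ ψ_k(s, v)` is two-sided. [folklore] -/
theorem hasDerivAt_kineticFibre (h : LinearBoltzmannData (Torus.geometry d) β α (fun x _ => ρ₀ x) R)
    (hd : 2 ≤ Fintype.card d) (k : d → ℤ) {t : ℝ} (ht : 0 < t) (v : 𝔼) :
    HasDerivAt
      (fun s : ℝ => kineticFibre k (linearBoltzmannSeries (Torus.geometry d) β α (fun x _ => ρ₀ x) s) v)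
      (-((α * collisionFrequency β v : ℝ) + fourierPhase k v * I) *
          kineticFibre k (linearBoltzmannSeries (Torus.geometry d) β α (fun x _ => ρ₀ x) t) v +
        (α : ℂ) * carlemanGainC β (kineticFibre k (linearBoltzmannSeries (Torus.geometry d) β α (fun x _ => ρ₀ x) t)) v)
      t := by
  obtain ⟨P, hP, heq⟩ := exists_hasDerivAt_extension_kineticFibre h hd k v
  rw [heq t ht.le]
  refine (hP t).congr_of_eventuallyEq ?_
  filter_upwards [Ioi_mem_nhds ht] with s hs
  exact heq s (le_of_lt hs)

end FibreIdentity

end Literature.MathematicalPhysics.KineticTheory
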